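import Mathlib
import Summits.MatrixMultiplication.MatrixMultiplication.Theorems.LevelGradedCohnUmansLevelOneGL2DesignsTangencyTorusOrbit

/-!
# Homogeneous split-torus records for the stub `stub_tangencySets`, certified in `O(p)` — table
(crux `LevelOneGL2Designs`, stmt-MatrixMultiplication-14080; wall-breaker axis 3/12)

Continuation of `…TangencyTorusOrbit`: for each prime below, the LARGEST subgroup `H = ⟨(a,b),(0,c)⟩`
of the split torus `(𝔽_p^×)² ≅ ℤ_{p−1}²` (HNF-normalised, `c ∣ (n/a)·b`) whose orbit through `(1,1)`
has a private non-vertical origin-avoiding line — found by exhaustive enumeration of all subgroups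
(`kit/srsjob/single_orbit.py` / `best_normalised_split`, this seat) — certified through
`srs_of_torusOrbit` by `p` evaluations of the character equations on the witness line:

| p | |T| | /p^{3/2} | (a,b,c) | index |
|---|---|---|---|---|
| 71 | 350 | 0.585 | (1,3,14) | 14 |
| 89 | 484 | 0.576 | (2,4,8) | 16 |
| 109 | 648 | 0.569 | (1,5,18) | 18 |
| 139 | 828 | 0.505 | (1,4,23) | 23 |
| 151 | 900 | 0.485 | (1,3,25) | 25 |
| 163 | 972 | 0.467 | (1,3,27) | 27 |
| 181 | 1080 | 0.444 | (1,3,30) | 30 |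
| 199 | 1188 | 0.423 | (1,4,33) | 33 |
| 211 | 1260 | 0.411 | (1,4,35) | 35 |
| 241 | 1920 | 0.513 | (1,8,30) | 30 |
| 281 | 1960 | 0.416 | (1,4,40) | 40 |
| 337 | 2352 | 0.380 | (1,5,48) | 48 |
| 401 | 3200 | 0.399 | (1,19,50) | 50 |

These are single orbits (`Θ(p log p)` objects, AXIS.md §B); at `p = 241` one orbit already gives
`0.513·p^{3/2}`, above every unstructured search on record at comparable `p`.  Nothing asymptotic
is claimed.
-/

set_option linter.dupNamespace false -- `MatrixMultiplication.MatrixMultiplication` (summit = problem, D-0017)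

open Finset Matrix

namespace Summit.MatrixMultiplication.MatrixMultiplication.Theorems.LevelOneGL2Designs.FlagLine

section InstancesTwo

/-- **Homogeneous record `T(71) ≥ 350`** (0.585·p^(3/2)): the orbit `{(7^(1i), 7^(3i+14j))}`
(`x^25·y^15 = 1`, index 14) with private line `27x + 45y = 1`. [computation, this seat] -/
theorem srs_torusOrbitAt_71_350 : ∃ S : Finset ((Fin 2 → ZMod 71) × (Fin 2 → ZMod 71)),
    350 ≤ S.card ∧ ∀ f ∈ S, ∀ f' ∈ S, (dotProduct f.1 f'.2 = 1 ↔ f = f') := by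
  have hord : orderOf (ZMod.unitOfCoprime 7 (by decide) : (ZMod 71)ˣ) = 70 := by
    refine orderOf_eq_of_pow_and_pow_div_prime (by norm_num) (by decide +kernel) ?_
    intro q hq hqd
    have hq' : q ∈ Nat.primeFactors 70 := Nat.mem_primeFactors.mpr ⟨hq, hqd, by norm_num⟩
    rw [show Nat.primeFactors 70 = {2, 5, 7} from by decide +kernel] at hq'
    simp only [Finset.mem_insert, Finset.mem_singleton] at hq'
    rcases hq' with rfl | rfl | rfl <;> decide +kernel
  exact srs_of_torusOrbit (p := 71) (ZMod.unitOfCoprime 7 (by decide)) 70 1 3 14 70 5 hord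
    (by norm_num) (by norm_num) (by norm_num) 25 15 0 0 (by decide) (by decide) (by decide) (by decide)
    27 45 30 (by decide) (by decide) (by decide +kernel)

/-- **Homogeneous record `T(89) ≥ 484`** (0.576·p^(3/2)): the orbit `{(3^(2i), 3^(4i+8j))}`
(`x^0·y^22 = 1 ∧ x^22·y^11 = 1`, index 16) with private line `2x + 88y = 1`. [computation, this seat] -/
theorem srs_torusOrbitAt_89_484 : ∃ S : Finset ((Fin 2 → ZMod 89) × (Fin 2 → ZMod 89)),
    484 ≤ S.card ∧ ∀ f ∈ S, ∀ f' ∈ S, (dotProduct f.1 f'.2 = 1 ↔ f = f') := by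
  have hord : orderOf (ZMod.unitOfCoprime 3 (by decide) : (ZMod 89)ˣ) = 88 := by
    refine orderOf_eq_of_pow_and_pow_div_prime (by norm_num) (by decide +kernel) ?_
    intro q hq hqd
    have hq' : q ∈ Nat.primeFactors 88 := Nat.mem_primeFactors.mpr ⟨hq, hqd, by norm_num⟩
    rw [show Nat.primeFactors 88 = {2, 11} from by decide +kernel] at hq'
    simp only [Finset.mem_insert, Finset.mem_singleton] at hq'
    rcases hq' with rfl | rfl <;> decide +kernel
  exact srs_of_torusOrbit (p := 89) (ZMod.unitOfCoprime 3 (by decide)) 88 2 4 8 44 11 hord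
    (by norm_num) (by norm_num) (by norm_num) 0 22 22 11 (by decide) (by decide) (by decide) (by decide)
    2 88 88 (by decide) (by decide) (by decide +kernel)

/-- **Homogeneous record `T(109) ≥ 648`** (0.569·p^(3/2)): the orbit `{(6^(1i), 6^(5i+18j))}`
(`x^6·y^42 = 1`, index 18) with private line `107x + 3y = 1`. [computation, this seat] -/
theorem srs_torusOrbitAt_109_648 : ∃ S : Finset ((Fin 2 → ZMod 109) × (Fin 2 → ZMod 109)),
    648 ≤ S.card ∧ ∀ f ∈ S, ∀ f' ∈ S, (dotProduct f.1 f'.2 = 1 ↔ f = f') := by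
  have hord : orderOf (ZMod.unitOfCoprime 6 (by decide) : (ZMod 109)ˣ) = 108 := by
    refine orderOf_eq_of_pow_and_pow_div_prime (by norm_num) (by decide +kernel) ?_
    intro q hq hqd
    have hq' : q ∈ Nat.primeFactors 108 := Nat.mem_primeFactors.mpr ⟨hq, hqd, by norm_num⟩
    rw [show Nat.primeFactors 108 = {2, 3} from by decide +kernel] at hq'
    simp only [Finset.mem_insert, Finset.mem_singleton] at hq'
    rcases hq' with rfl | rfl <;> decide +kernel
  exact srs_of_torusOrbit (p := 109) (ZMod.unitOfCoprime 6 (by decide)) 108 1 5 18 108 6 hord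
    (by norm_num) (by norm_num) (by norm_num) 6 42 0 0 (by decide) (by decide) (by decide) (by decide)
    107 3 73 (by decide) (by decide) (by decide +kernel)

/-- **Homogeneous record `T(139) ≥ 828`** (0.505·p^(3/2)): the orbit `{(2^(1i), 2^(4i+23j))}`
(`x^18·y^30 = 1`, index 23) with private line `50x + 90y = 1`. [computation, this seat] -/
theorem srs_torusOrbitAt_139_828 : ∃ S : Finset ((Fin 2 → ZMod 139) × (Fin 2 → ZMod 139)),
    828 ≤ S.card ∧ ∀ f ∈ S, ∀ f' ∈ S, (dotProduct f.1 f'.2 = 1 ↔ f = f') := by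
  have hord : orderOf (ZMod.unitOfCoprime 2 (by decide) : (ZMod 139)ˣ) = 138 := by
    refine orderOf_eq_of_pow_and_pow_div_prime (by norm_num) (by decide +kernel) ?_
    intro q hq hqd
    have hq' : q ∈ Nat.primeFactors 138 := Nat.mem_primeFactors.mpr ⟨hq, hqd, by norm_num⟩
    rw [show Nat.primeFactors 138 = {2, 3, 23} from by decide +kernel] at hq'
    simp only [Finset.mem_insert, Finset.mem_singleton] at hq'
    rcases hq' with rfl | rfl | rfl <;> decide +kernel
  exact srs_of_torusOrbit (p := 139) (ZMod.unitOfCoprime 2 (by decide)) 138 1 4 23 138 6 hord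
    (by norm_num) (by norm_num) (by norm_num) 18 30 0 0 (by decide) (by decide) (by decide) (by decide)
    50 90 17 (by decide) (by decide) (by decide +kernel)

/-- **Homogeneous record `T(151) ≥ 900`** (0.485·p^(3/2)): the orbit `{(6^(1i), 6^(3i+25j))}`
(`x^6·y^48 = 1`, index 25) with private line `14x + 138y = 1`. [computation, this seat] -/
theorem srs_torusOrbitAt_151_900 : ∃ S : Finset ((Fin 2 → ZMod 151) × (Fin 2 → ZMod 151)),
    900 ≤ S.card ∧ ∀ f ∈ S, ∀ f' ∈ S, (dotProduct f.1 f'.2 = 1 ↔ f = f') := by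
  have hord : orderOf (ZMod.unitOfCoprime 6 (by decide) : (ZMod 151)ˣ) = 150 := by
    refine orderOf_eq_of_pow_and_pow_div_prime (by norm_num) (by decide +kernel) ?_
    intro q hq hqd
    have hq' : q ∈ Nat.primeFactors 150 := Nat.mem_primeFactors.mpr ⟨hq, hqd, by norm_num⟩
    rw [show Nat.primeFactors 150 = {2, 3, 5} from by decide +kernel] at hq'
    simp only [Finset.mem_insert, Finset.mem_singleton] at hq'
    rcases hq' with rfl | rfl | rfl <;> decide +kernel
  exact srs_of_torusOrbit (p := 151) (ZMod.unitOfCoprime 6 (by decide)) 150 1 3 25 150 6 hord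
    (by norm_num) (by norm_num) (by norm_num) 6 48 0 0 (by decide) (by decide) (by decide) (by decide)
    14 138 58 (by decide) (by decide) (by decide +kernel)

/-- **Homogeneous record `T(163) ≥ 972`** (0.467·p^(3/2)): the orbit `{(2^(1i), 2^(3i+27j))}`
(`x^18·y^48 = 1`, index 27) with private line `42x + 122y = 1`. [computation, this seat] -/
theorem srs_torusOrbitAt_163_972 : ∃ S : Finset ((Fin 2 → ZMod 163) × (Fin 2 → ZMod 163)),
    972 ≤ S.card ∧ ∀ f ∈ S, ∀ f' ∈ S, (dotProduct f.1 f'.2 = 1 ↔ f = f') := by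
  have hord : orderOf (ZMod.unitOfCoprime 2 (by decide) : (ZMod 163)ˣ) = 162 := by
    refine orderOf_eq_of_pow_and_pow_div_prime (by norm_num) (by decide +kernel) ?_
    intro q hq hqd
    have hq' : q ∈ Nat.primeFactors 162 := Nat.mem_primeFactors.mpr ⟨hq, hqd, by norm_num⟩
    rw [show Nat.primeFactors 162 = {2, 3} from by decide +kernel] at hq'
    simp only [Finset.mem_insert, Finset.mem_singleton] at hq'
    rcases hq' with rfl | rfl <;> decide +kernel
  exact srs_of_torusOrbit (p := 163) (ZMod.unitOfCoprime 2 (by decide)) 162 1 3 27 162 6 hord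
    (by norm_num) (by norm_num) (by norm_num) 18 48 0 0 (by decide) (by decide) (by decide) (by decide)
    42 122 159 (by decide) (by decide) (by decide +kernel)

/-- **Homogeneous record `T(181) ≥ 1080`** (0.444·p^(3/2)): the orbit `{(2^(1i), 2^(3i+30j))}`
(`x^54·y^42 = 1`, index 30) with private line `119x + 63y = 1`. [computation, this seat] -/
theorem srs_torusOrbitAt_181_1080 : ∃ S : Finset ((Fin 2 → ZMod 181) × (Fin 2 → ZMod 181)),
    1080 ≤ S.card ∧ ∀ f ∈ S, ∀ f' ∈ S, (dotProduct f.1 f'.2 = 1 ↔ f = f') := by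
  have hord : orderOf (ZMod.unitOfCoprime 2 (by decide) : (ZMod 181)ˣ) = 180 := by
    refine orderOf_eq_of_pow_and_pow_div_prime (by norm_num) (by decide +kernel) ?_
    intro q hq hqd
    have hq' : q ∈ Nat.primeFactors 180 := Nat.mem_primeFactors.mpr ⟨hq, hqd, by norm_num⟩
    rw [show Nat.primeFactors 180 = {2, 3, 5} from by decide +kernel] at hq'
    simp only [Finset.mem_insert, Finset.mem_singleton] at hq'
    rcases hq' with rfl | rfl | rfl <;> decide +kernel
  exact srs_of_torusOrbit (p := 181) (ZMod.unitOfCoprime 2 (by decide)) 180 1 3 30 180 6 hord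
    (by norm_num) (by norm_num) (by norm_num) 54 42 0 0 (by decide) (by decide) (by decide) (by decide)
    119 63 23 (by decide) (by decide) (by decide +kernel)

/-- **Homogeneous record `T(199) ≥ 1188`** (0.423·p^(3/2)): the orbit `{(3^(1i), 3^(4i+33j))}`
(`x^6·y^48 = 1`, index 33) with private line `160x + 40y = 1`. [computation, this seat] -/
theorem srs_torusOrbitAt_199_1188 : ∃ S : Finset ((Fin 2 → ZMod 199) × (Fin 2 → ZMod 199)),
    1188 ≤ S.card ∧ ∀ f ∈ S, ∀ f' ∈ S, (dotProduct f.1 f'.2 = 1 ↔ f = f') := by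
  have hord : orderOf (ZMod.unitOfCoprime 3 (by decide) : (ZMod 199)ˣ) = 198 := by
    refine orderOf_eq_of_pow_and_pow_div_prime (by norm_num) (by decide +kernel) ?_
    intro q hq hqd
    have hq' : q ∈ Nat.primeFactors 198 := Nat.mem_primeFactors.mpr ⟨hq, hqd, by norm_num⟩
    rw [show Nat.primeFactors 198 = {2, 3, 11} from by decide +kernel] at hq'
    simp only [Finset.mem_insert, Finset.mem_singleton] at hq'
    rcases hq' with rfl | rfl | rfl <;> decide +kernel
  exact srs_of_torusOrbit (p := 199) (ZMod.unitOfCoprime 3 (by decide)) 198 1 4 33 198 6 hord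
    (by norm_num) (by norm_num) (by norm_num) 6 48 0 0 (by decide) (by decide) (by decide) (by decide)
    160 40 5 (by decide) (by decide) (by decide +kernel)

/-- **Homogeneous record `T(211) ≥ 1260`** (0.411·p^(3/2)): the orbit `{(2^(1i), 2^(4i+35j))}`
(`x^18·y^48 = 1`, index 35) with private line `13x + 199y = 1`. [computation, this seat] -/
theorem srs_torusOrbitAt_211_1260 : ∃ S : Finset ((Fin 2 → ZMod 211) × (Fin 2 → ZMod 211)),
    1260 ≤ S.card ∧ ∀ f ∈ S, ∀ f' ∈ S, (dotProduct f.1 f'.2 = 1 ↔ f = f') := by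
  have hord : orderOf (ZMod.unitOfCoprime 2 (by decide) : (ZMod 211)ˣ) = 210 := by
    refine orderOf_eq_of_pow_and_pow_div_prime (by norm_num) (by decide +kernel) ?_
    intro q hq hqd
    have hq' : q ∈ Nat.primeFactors 210 := Nat.mem_primeFactors.mpr ⟨hq, hqd, by norm_num⟩
    rw [show Nat.primeFactors 210 = {2, 3, 5, 7} from by decide +kernel] at hq'
    simp only [Finset.mem_insert, Finset.mem_singleton] at hq'
    rcases hq' with rfl | rfl | rfl | rfl <;> decide +kernel
  exact srs_of_torusOrbit (p := 211) (ZMod.unitOfCoprime 2 (by decide)) 210 1 4 35 210 6 hord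
    (by norm_num) (by norm_num) (by norm_num) 18 48 0 0 (by decide) (by decide) (by decide) (by decide)
    13 199 123 (by decide) (by decide) (by decide +kernel)

/-- **Homogeneous record `T(241) ≥ 1920`** (0.513·p^(3/2)): the orbit `{(7^(1i), 7^(8i+30j))}`
(`x^32·y^56 = 1`, index 30) with private line `110x + 132y = 1`. [computation, this seat] -/
theorem srs_torusOrbitAt_241_1920 : ∃ S : Finset ((Fin 2 → ZMod 241) × (Fin 2 → ZMod 241)),
    1920 ≤ S.card ∧ ∀ f ∈ S, ∀ f' ∈ S, (dotProduct f.1 f'.2 = 1 ↔ f = f') := by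
  have hord : orderOf (ZMod.unitOfCoprime 7 (by decide) : (ZMod 241)ˣ) = 240 := by
    refine orderOf_eq_of_pow_and_pow_div_prime (by norm_num) (by decide +kernel) ?_
    intro q hq hqd
    have hq' : q ∈ Nat.primeFactors 240 := Nat.mem_primeFactors.mpr ⟨hq, hqd, by norm_num⟩
    rw [show Nat.primeFactors 240 = {2, 3, 5} from by decide +kernel] at hq'
    simp only [Finset.mem_insert, Finset.mem_singleton] at hq'
    rcases hq' with rfl | rfl | rfl <;> decide +kernel
  exact srs_of_torusOrbit (p := 241) (ZMod.unitOfCoprime 7 (by decide)) 240 1 8 30 240 8 hord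
    (by norm_num) (by norm_num) (by norm_num) 32 56 0 0 (by decide) (by decide) (by decide) (by decide)
    110 132 42 (by decide) (by decide) (by decide +kernel)

/-- **Homogeneous record `T(281) ≥ 1960`** (0.416·p^(3/2)): the orbit `{(3^(1i), 3^(4i+40j))}`
(`x^28·y^63 = 1`, index 40) with private line `217x + 65y = 1`. [computation, this seat] -/
theorem srs_torusOrbitAt_281_1960 : ∃ S : Finset ((Fin 2 → ZMod 281) × (Fin 2 → ZMod 281)),
    1960 ≤ S.card ∧ ∀ f ∈ S, ∀ f' ∈ S, (dotProduct f.1 f'.2 = 1 ↔ f = f') := by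
  have hord : orderOf (ZMod.unitOfCoprime 3 (by decide) : (ZMod 281)ˣ) = 280 := by
    refine orderOf_eq_of_pow_and_pow_div_prime (by norm_num) (by decide +kernel) ?_
    intro q hq hqd
    have hq' : q ∈ Nat.primeFactors 280 := Nat.mem_primeFactors.mpr ⟨hq, hqd, by norm_num⟩
    rw [show Nat.primeFactors 280 = {2, 5, 7} from by decide +kernel] at hq'
    simp only [Finset.mem_insert, Finset.mem_singleton] at hq'
    rcases hq' with rfl | rfl | rfl <;> decide +kernel
  exact srs_of_torusOrbit (p := 281) (ZMod.unitOfCoprime 3 (by decide)) 280 1 4 40 280 7 hord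
    (by norm_num) (by norm_num) (by norm_num) 28 63 0 0 (by decide) (by decide) (by decide) (by decide)
    217 65 147 (by decide) (by decide) (by decide +kernel)

/-- **Homogeneous record `T(337) ≥ 2352`** (0.380·p^(3/2)): the orbit `{(10^(1i), 10^(5i+48j))}`
(`x^7·y^133 = 1`, index 48) with private line `7x + 331y = 1`. [computation, this seat] -/
theorem srs_torusOrbitAt_337_2352 : ∃ S : Finset ((Fin 2 → ZMod 337) × (Fin 2 → ZMod 337)),
    2352 ≤ S.card ∧ ∀ f ∈ S, ∀ f' ∈ S, (dotProduct f.1 f'.2 = 1 ↔ f = f') := by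
  have hord : orderOf (ZMod.unitOfCoprime 10 (by decide) : (ZMod 337)ˣ) = 336 := by
    refine orderOf_eq_of_pow_and_pow_div_prime (by norm_num) (by decide +kernel) ?_
    intro q hq hqd
    have hq' : q ∈ Nat.primeFactors 336 := Nat.mem_primeFactors.mpr ⟨hq, hqd, by norm_num⟩
    rw [show Nat.primeFactors 336 = {2, 3, 7} from by decide +kernel] at hq'
    simp only [Finset.mem_insert, Finset.mem_singleton] at hq'
    rcases hq' with rfl | rfl | rfl <;> decide +kernel
  exact srs_of_torusOrbit (p := 337) (ZMod.unitOfCoprime 10 (by decide)) 336 1 5 48 336 7 hord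
    (by norm_num) (by norm_num) (by norm_num) 7 133 0 0 (by decide) (by decide) (by decide) (by decide)
    7 331 56 (by decide) (by decide) (by decide +kernel)

/-- **Homogeneous record `T(401) ≥ 3200`** (0.399·p^(3/2)): the orbit `{(3^(1i), 3^(19i+50j))}`
(`x^24·y^104 = 1`, index 50) with private line `396x + 6y = 1`. [computation, this seat] -/
theorem srs_torusOrbitAt_401_3200 : ∃ S : Finset ((Fin 2 → ZMod 401) × (Fin 2 → ZMod 401)),
    3200 ≤ S.card ∧ ∀ f ∈ S, ∀ f' ∈ S, (dotProduct f.1 f'.2 = 1 ↔ f = f') := by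
  have hord : orderOf (ZMod.unitOfCoprime 3 (by decide) : (ZMod 401)ˣ) = 400 := by
    refine orderOf_eq_of_pow_and_pow_div_prime (by norm_num) (by decide +kernel) ?_
    intro q hq hqd
    have hq' : q ∈ Nat.primeFactors 400 := Nat.mem_primeFactors.mpr ⟨hq, hqd, by norm_num⟩
    rw [show Nat.primeFactors 400 = {2, 5} from by decide +kernel] at hq'
    simp only [Finset.mem_insert, Finset.mem_singleton] at hq'
    rcases hq' with rfl | rfl <;> decide +kernel
  exact srs_of_torusOrbit (p := 401) (ZMod.unitOfCoprime 3 (by decide)) 400 1 19 50 400 8 hord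
    (by norm_num) (by norm_num) (by norm_num) 24 104 0 0 (by decide) (by decide) (by decide) (by decide)
    396 6 67 (by decide) (by decide) (by decide +kernel)

end InstancesTwo

end Summit.MatrixMultiplication.MatrixMultiplication.Theorems.LevelOneGL2Designs.FlagLine
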